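/-
Copyright (c) 2026 the pub-hodgecm-mathlib formalisation cell (harness21).  Prover seat hodgecm-mathlib-F0P2-p10 (g4), Track B ∕ R90-TF, h413 = `stmt-HodgeConjecture-24833`,
R90-TF section S8 «ContSpec-n½», socket (E) :276, E1-PLANCHEREL BODY brick PB-1a (S8 dealer R90-CS-plan (g4) S8-R254 (8)+(9); joint census `R90/S8/CENSUS-PlancherelBody-bricks…`
§PB-1, my block `R90/S8/CENSUS-PlancherelBody-PB1.F0P2-p10-g4.md`): the BRACKET DECOMPOSITION of `⟨θ_{f,φ}, θ_{f′,φ′}⟩_X` on `U(2,1)_{L∕L⁺}` for ANY two Borel pair data — the `hna`-free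
first half of ★ C4b p863211 `K2E1ChiPseudoEisensteinInnerProductCMThree`, exported as a HEAD.
-/
import Summits.HodgeConjecture.HodgeConjecture.Theorems.K2E1ChiPseudoEisensteinWeightBracketsCMThree       -- ★ C4a (this seat): ENGINE + the two weighted brackets; brings ★ C3, ★ C3′, ★ C1, ★ GR-χ
import Summits.HodgeConjecture.HodgeConjecture.Theorems.K2E1ChiPseudoEisensteinRadialCMThree               -- ★ C2 p862856 (this seat): `θ_{f,ψ}` on `U(2,1)`: Borel, bounded, constant term; brings ★ D0 §3 every-rank unfolding
import Summits.HodgeConjecture.HodgeConjecture.Theorems.K2E1ChiPseudoEisensteinFamiliesOrthogonalCMThree   -- ★ R6₃ «of letters» p862757 (this seat): `hBO_of_pairXF`, `chiSectionSpacePair`, `resGBlock`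
import Summits.HodgeConjecture.HodgeConjecture.Theorems.K2E1ChiPseudoEisensteinFamiliesOrthogonalRayTrivialCMTwo -- ★ (K2E1-p16): `not_isNormTwist_mul_inv_of_rayTrivial_of_ne`, `…_reflectChar_…'`; brings ★ `norm_borelConstantTerm_le`
import Summits.HodgeConjecture.HodgeConjecture.Theorems.K2E1BorelWeightAverage                              -- ★ AVG₃ `integral_wt_smul_mul_conj_eq_mul_conj_borelConstantTerm_three`
import Summits.HodgeConjecture.HodgeConjecture.Theorems.K2E1HeisenbergHaarU3                                 -- ★ `isInvInvariant_of_isHaarMeasure_adelicUnipotent_three`, `locallyCompactSpace_and_secondCountableTopology_adelicUnipotent`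
import Literature.NumberTheory.Automorphic.UnitaryGroupBorelConstantTermInvariance                           -- ★ `borelConstantTerm_rational_borel_mul_of_rational_invariant`
import HarnessLib

/-!
# PB-1a — `K2E1ChiPseudoEisensteinBracketsCMThree`: `⟨θ_{f,φ}, θ_{f′,φ′}⟩_X = c_μ·([Ψ₁]_β + [Ψ₂]_β)` — THE UNFOLDED INNER PRODUCT OF TWO TWISTED PSEUDO-EISENSTEIN SERIES ON `U(2,1)_{L∕L⁺}`
# AS THE SUM OF THE DIAGONAL AND THE INTERTWINED BRACKET, FOR ANY TWO PAIR DATA (no non-association hypothesis, no Mellin transform)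

Track B ∕ R90-TF, crux h413 = `stmt-HodgeConjecture-24833`, route of record `HCCMUnconditional`; cell `hodgecm-mathlib`, R90-TF programme, section S8 «ContSpec-n½», socket (E)
(B ED. 7 :276): the E1-PLANCHEREL BODY (census-E4 row (5): (L2) `U_Λ s hs hUΛ` + (C) `hC`), cut into bricks PB-1…PB-4 (S8-R254).  PB-1 = the inner-product formula of two τ-cut wave
packets as a line integral; PB-1a (THIS FILE) is its measure-theoretic first half.  THEOREMS ONLY (no `def`, no `instance`, no `notation`, no named-fact hypothesis, no `sorry`; default
heartbeats); lane `--supports stmt-HodgeConjecture-24833 --as helper` (count-neutral).  CLOSES NO SOCKET.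

THE MATHEMATICS ([MoeglinWaldspurger1995] II.1.7, II.2.1; [Rogawski1990] §7.3 pp. 96–98, §13.9 p. 229).  Borel pair data `(χ₁, χ₂)`, `(χ₁′, χ₂′)` on `U(J₃)` over the CM pair
`(L⁺, L, conj)` (`χ₂, χ₂′` automorphic; NO unitarity, NO non-association hypothesis), continuous bounded pair sections `φ, φ′`, continuous profiles `f, f′ ∈ C_c((0,∞))`,
`θ_{f,φ} = E((f∘H)·φ)`.  Exactly as in ★ C4b's proof, steps (0)–(3): UNFOLD `X → B(L⁺)`-weight level against a covering weight `β` of `B(L⁺)♯` (★ every-rank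
`exists_integral_quotFun_eisensteinSeriesU_mul_conj_eq`: `∫_X θ·conj θ′ dμ = c_μ·∫_{G(𝔸)} β•((f∘H)φ·conj θ′) dν_G`, `c_μ > 0` depending on `(μ, ν_G)` only); the average is free (★ AVG₃
`integral_wt_smul_mul_conj_eq_mul_conj_borelConstantTerm_three`): `θ′ ↦ θ′_B`; the constant term (★ C2 `borelConstantTerm_eisensteinSeriesU_comp_borelHeight_mul_cm_three`) is `θ′_B = (f′∘H)φ′ + J`
with the INTERTWINED PIECE `J = (ν𝓕)⁻¹•∫_{N(𝔸)}(f′∘H)(w₀v·)φ′(w₀v·)dν`; so with `Ψ₁ := (f∘H)φ·conj((f′∘H)φ′)` (DIAGONAL) and `Ψ₂ := (f∘H)φ·conj J` (INTERTWINED):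
**`∫_X θ_{f,φ}·conj θ_{f′,φ′} dμ = c_μ·([Ψ₁]_β + [Ψ₂]_β)`**, both brackets absolutely convergent (the `L¹` letter `∫⁻ β‖(f∘H)φ‖ < ∞` from ★ (δ)₃ + ★ `setLIntegral_normSq_inv_mul_enorm_comp_lt_top`,
and `(f′∘H)φ′`, `J` bounded — ★ `exists_bound_eisensteinSeriesU_comp_borelHeight_mul_cm_three`, ★ `norm_borelConstantTerm_le`).  ★ C4b then kills both brackets under its
non-association hypothesis (★ C4a); PB-1b evaluates `[Ψ₁]_β` for the SAME unitary pair data by Tate's `d^×x` and Mellin–Parseval; PB-1c (the intertwined bracket through the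
operator-valued Mellin step `⟪φ, M(w₀, z)φ′⟫_{K_U}`) is the analytic brick where PB-1 meets PB-2∕PB-3.
* §1 **`chiPseudoEisenstein_inner_product_eq_brackets_cm_three`** — structural data `(μ, ν_G, μ_K, ν_I, 𝓕_I, ν, 𝓕)` as in ★ C4b; `∃ c_μ > 0` BEFORE `∀ β (hβ) (pair data) (sections)
  (profiles)`: `Integrable` on `X`, both brackets `Integrable` on `G(𝔸)`, and the decomposition (the intertwined piece spelled `borelConstantTerm ν 𝓕 θ′ g − (f′∘H)φ′(g)`, whose closed
  form is ★ C2 by name).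
HONEST LABEL: HC_CM is proved only modulo the 7 printed citations (2 remaining named inputs: hLiu418 = `stmt-HodgeConjecture-24832`, h413 = `stmt-HodgeConjecture-24833`) until rung 0
closes; REL ≠ ★ ≠ BUILT; this file asserts no named fact and closes no socket — PB-1a is bookkeeping toward the XL E1-Plancherel body (census-E4 (5)), nothing more; count-neutral;
letter-free (structural measure data only).

## References
* [MoeglinWaldspurger1995] C. Mœglin, J.-L. Waldspurger, *Spectral Decomposition and Eisenstein Series* (1995), II.1.7, II.2.1, IV.2.
* [Rogawski1990] J. D. Rogawski, *Automorphic Representations of Unitary Groups in Three Variables* (1990), §7.3 pp. 96–98, §13.9 p. 229.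
-/

set_option autoImplicit false
set_option linter.dupNamespace false  -- the mandated namespace repeats the summit's segment (`HodgeConjecture.HodgeConjecture`)

noncomputable section

open MeasureTheory Measure Set Filter Topology Complex NumberField IsDedekindDomain MulAction
open scoped Real NNReal ENNReal ComplexConjugate InnerProductSpace
open Literature.MeasureTheory.Group Literature.NumberTheory
open Literature.NumberTheory.Automorphic Literature.NumberTheory.Automorphic.UnitaryGroup AdelicGroupData
open Literature.NumberTheory.GaloisRepresentations (HeckeCharacter ideleGroup)
open Literature.NumberTheory.Automorphic.Arthur2013.Leaves.TECR
open Summit.HodgeConjecture.HodgeConjecture.Cruxes.H413.K2E1BorelEisensteinU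
open Summit.HodgeConjecture.HodgeConjecture.Cruxes.H413.K2E1CharacterEisensteinU2Defs
open Summit.HodgeConjecture.HodgeConjecture.Cruxes.H413.K2E1CharacterEisensteinU3PairDefs
open Summit.HodgeConjecture.HodgeConjecture.Cruxes.H413.K2E1ChiSectionSpaceU3PairDefs
open Summit.HodgeConjecture.HodgeConjecture.Cruxes.H413.K2E1PseudoEisensteinRadialCMTwo (exists_integral_quotFun_eisensteinSeriesU_mul_conj_eq lintegral_weight_mul_conj_lt_top)
open Summit.HodgeConjecture.HodgeConjecture.Cruxes.H413.K2E1ChiPseudoEisensteinRadialCMTwo (comp_borelHeight_mul_arithmeticBorel_mul comp_borelHeight_mul_unipotent_mul eisensteinSeriesU_comp_borelHeight_mul_arithmeticSubgroup_mul)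
open Summit.HodgeConjecture.HodgeConjecture.Cruxes.H413.K2E1ChiPseudoEisensteinRadialCMThree (measurable_eisensteinSeriesU_comp_borelHeight_mul_cm_three exists_bound_eisensteinSeriesU_comp_borelHeight_mul_cm_three borelConstantTerm_eisensteinSeriesU_comp_borelHeight_mul_cm_three)
open Summit.HodgeConjecture.HodgeConjecture.Cruxes.H413.K2E1ChiSectionTorusAverageU3 (borelHeight_torus_mul_maximalCompact_three)
open Summit.HodgeConjecture.HodgeConjecture.Cruxes.H413.K2E1ChiPseudoEisensteinIdeleSplitCMThree (setLIntegral_normSq_inv_mul_enorm_comp_lt_top)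
open Summit.HodgeConjecture.HodgeConjecture.Cruxes.H413.K2E1ChiPseudoEisensteinWeightBracketsCMThree (integral_weight_smul_wOne_eq_zero_cm_three integral_weight_smul_wZero_eq_zero_cm_three)
open Summit.HodgeConjecture.HodgeConjecture.Cruxes.H413.K2E1EisensteinPairingUnfoldedWeight (exists_integral_weight_smul_eq_mul_setIntegral_ideleClass_three)
open Summit.HodgeConjecture.HodgeConjecture.Cruxes.H413.K2E1BorelWeightAverage (integral_wt_smul_mul_conj_eq_mul_conj_borelConstantTerm_three)
open Summit.HodgeConjecture.HodgeConjecture.Cruxes.H413.K2E1TruncatedEisensteinBoundedCMThree (measurable_borelConstantTerm)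
open Summit.HodgeConjecture.HodgeConjecture.Cruxes.H413.K2E1ChiPseudoEisensteinIdeleLevelCMTwo (norm_borelConstantTerm_le)
open Summit.HodgeConjecture.HodgeConjecture.Cruxes.H413.K2E1ChiPseudoEisensteinFamiliesOrthogonalRayTrivialCMTwo (not_isNormTwist_mul_inv_of_rayTrivial_of_ne not_isNormTwist_mul_inv_reflectChar_of_rayTrivial_of_ne')
open Summit.HodgeConjecture.HodgeConjecture.Cruxes.H413.K2E1ChiPseudoEisensteinFamiliesOrthogonalCMThree (hBO_of_pairXF)
open Summit.HodgeConjecture.HodgeConjecture.Cruxes.H413.K2E1HeisenbergHaarU3 (isInvInvariant_of_isHaarMeasure_adelicUnipotent_three locallyCompactSpace_and_secondCountableTopology_adelicUnipotent)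
open Summit.HodgeConjecture.HodgeConjecture.R90.S8 (resGBlock)

namespace Summit.HodgeConjecture.HodgeConjecture.Cruxes.H413.K2E1ChiPseudoEisensteinBracketsCMThree

variable (L : Type) [Field L] [NumberField L] [IsCMField L]
variable [MeasurableSpace (quasiSplit (↥(maximalRealSubfield L)) L (IsCMField.complexConj L) 3).Adelic] [BorelSpace (quasiSplit (↥(maximalRealSubfield L)) L (IsCMField.complexConj L) 3).Adelic]
variable [MeasurableSpace (AdeleRing (𝓞 L) L)ˣ] [BorelSpace (AdeleRing (𝓞 L) L)ˣ]

/-! ## §1 The bracket decomposition of the unfolded inner product, for ANY two pair data -/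

/-- **PB-1a — THE BRACKET DECOMPOSITION `⟨θ_{f,φ}, θ_{f′,φ′}⟩_X = c_μ·([Ψ₁]_β + [Ψ₂]_β)` FOR ANY TWO PAIR DATA.**  Structural data: an automorphic `μ` on `X`, an inversion-invariant Haar
`ν_G`, Haar `μ_K` on `K_U`, `ν_I` on `𝕀_L` with an idele class domain `𝓕_I`, `ν` on `N(𝔸)` with a fundamental domain `𝓕` of `N(L⁺)` of compact closure.  There is `c_μ > 0` (depending on
`(μ, ν_G)` only) such that for every covering weight `β` of `B(L⁺)♯`, all Hecke characters `χ₁, χ₁′`, AUTOMORPHIC `U(1)`-characters `χ₂, χ₂′`, continuous bounded pair sections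
`φ ∈ (χ₁,χ₂)`, `φ′ ∈ (χ₁′,χ₂′)` and continuous `f, f′ ∈ C_c((0,∞))`: the pairing of `θ_{f,φ}` and `θ_{f′,φ′}` over `X` is `μ`-integrable, the DIAGONAL bracket `β•((f∘H)φ·conj((f′∘H)φ′))`
and the INTERTWINED bracket `β•((f∘H)φ·conj(θ′_B − (f′∘H)φ′))` are `ν_G`-integrable, and **`∫_X θ_{f,φ}·conj θ_{f′,φ′} dμ = c_μ·(∫ β•Ψ₁ dν_G + ∫ β•Ψ₂ dν_G)`** (unfolding ★, AVG₃ ★,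
constant term ★ C2 — the `hna`-free steps (0)–(3) of ★ C4b `chiPseudoEisenstein_inner_product_eq_zero_cm_three`). [cite: MoeglinWaldspurger1995, II.2.1]
[cite: Rogawski1990, §7.3 (pp. 96–98)] -/
theorem chiPseudoEisenstein_inner_product_eq_brackets_cm_three
    (μ : Measure (quasiSplit (↥(maximalRealSubfield L)) L (IsCMField.complexConj L) 3).automorphicQuotient) [(quasiSplit (↥(maximalRealSubfield L)) L (IsCMField.complexConj L) 3).IsAutomorphicMeasure μ]
    (νG : Measure (quasiSplit (↥(maximalRealSubfield L)) L (IsCMField.complexConj L) 3).Adelic) [νG.IsHaarMeasure] [νG.IsInvInvariant]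
    (μK : Measure ((standardMaximalCompactGL 3 L).comap (adelicVal (↥(maximalRealSubfield L)) L (IsCMField.complexConj L) 3 ((StdForm.antidiagonal 3).over L)) : Subgroup (quasiSplit (↥(maximalRealSubfield L)) L (IsCMField.complexConj L) 3).Adelic)) [μK.IsHaarMeasure]
    (νI : Measure (AdeleRing (𝓞 L) L)ˣ) [νI.IsHaarMeasure]
    {𝓕I : Set (AdeleRing (𝓞 L) L)ˣ} (h𝓕I : IsIdeleClassDomain L 𝓕I)
    (ν : Measure ↥(adelicUnipotent (↥(maximalRealSubfield L)) L (IsCMField.complexConj L) 3)) [ν.IsHaarMeasure] {𝓕 : Set ↥(adelicUnipotent (↥(maximalRealSubfield L)) L (IsCMField.complexConj L) 3)}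
    (h𝓕N : IsFundamentalDomain ↥(rationalUnipotent (↥(maximalRealSubfield L)) L (IsCMField.complexConj L) 3) 𝓕 ν) (h𝓕c : IsCompact (closure 𝓕)) :
    ∃ cμ : ℝ, 0 < cμ ∧
      ∀ {β : (quasiSplit (↥(maximalRealSubfield L)) L (IsCMField.complexConj L) 3).Adelic → ℝ≥0∞}, IsCoveringWeight ((arithmeticBorel (↥(maximalRealSubfield L)) L (IsCMField.complexConj L) 3).map (quasiSplit (↥(maximalRealSubfield L)) L (IsCMField.complexConj L) 3).arithmeticSubgroup.subtype) β →
      ∀ {χ₁ χ₁' : HeckeCharacter L} {χ₂ χ₂' : ↥(TorusDict.torus (IsCMField.complexConj L)) →ₜ* ℂˣ} {φ φ' : (quasiSplit (↥(maximalRealSubfield L)) L (IsCMField.complexConj L) 3).Adelic → ℂ},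
        TorusDict.IsAutomorphic (IsCMField.complexConj L) χ₂ → TorusDict.IsAutomorphic (IsCMField.complexConj L) χ₂' →
        IsChiSectionPair χ₁ χ₂ φ → Continuous φ → ∀ {Cφ : ℝ}, (∀ x, ‖φ x‖ ≤ Cφ) →
        IsChiSectionPair χ₁' χ₂' φ' → Continuous φ' → ∀ {Cφ' : ℝ}, (∀ x, ‖φ' x‖ ≤ Cφ') →
      ∀ {f f' : ℝ → ℂ}, Continuous f → HasCompactSupport f → tsupport f ⊆ Ioi 0 → Continuous f' → HasCompactSupport f' → tsupport f' ⊆ Ioi 0 →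
        Integrable (fun x : (quasiSplit (↥(maximalRealSubfield L)) L (IsCMField.complexConj L) 3).automorphicQuotient => (quasiSplit (↥(maximalRealSubfield L)) L (IsCMField.complexConj L) 3).quotFun (eisensteinSeriesU (fun g : (quasiSplit (↥(maximalRealSubfield L)) L (IsCMField.complexConj L) 3).Adelic => f (borelHeight g : ℝ) * φ g)) x * conj ((quasiSplit (↥(maximalRealSubfield L)) L (IsCMField.complexConj L) 3).quotFun (eisensteinSeriesU (fun g : (quasiSplit (↥(maximalRealSubfield L)) L (IsCMField.complexConj L) 3).Adelic => f' (borelHeight g : ℝ) * φ' g)) x)) μ ∧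
        Integrable (fun g : (quasiSplit (↥(maximalRealSubfield L)) L (IsCMField.complexConj L) 3).Adelic => (β g).toReal • (f (borelHeight g : ℝ) * φ g * conj (f' (borelHeight g : ℝ) * φ' g))) νG ∧
        Integrable (fun g : (quasiSplit (↥(maximalRealSubfield L)) L (IsCMField.complexConj L) 3).Adelic => (β g).toReal • (f (borelHeight g : ℝ) * φ g * conj (borelConstantTerm ν 𝓕 (eisensteinSeriesU (fun g : (quasiSplit (↥(maximalRealSubfield L)) L (IsCMField.complexConj L) 3).Adelic => f' (borelHeight g : ℝ) * φ' g)) g - f' (borelHeight g : ℝ) * φ' g))) νG ∧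
        ∫ x, (quasiSplit (↥(maximalRealSubfield L)) L (IsCMField.complexConj L) 3).quotFun (eisensteinSeriesU (fun g : (quasiSplit (↥(maximalRealSubfield L)) L (IsCMField.complexConj L) 3).Adelic => f (borelHeight g : ℝ) * φ g)) x * conj ((quasiSplit (↥(maximalRealSubfield L)) L (IsCMField.complexConj L) 3).quotFun (eisensteinSeriesU (fun g : (quasiSplit (↥(maximalRealSubfield L)) L (IsCMField.complexConj L) 3).Adelic => f' (borelHeight g : ℝ) * φ' g)) x) ∂μ =
          (cμ : ℂ) * ((∫ g, (fun g : (quasiSplit (↥(maximalRealSubfield L)) L (IsCMField.complexConj L) 3).Adelic => (β g).toReal • (f (borelHeight g : ℝ) * φ g * conj (f' (borelHeight g : ℝ) * φ' g))) g ∂νG) + ∫ g, (fun g : (quasiSplit (↥(maximalRealSubfield L)) L (IsCMField.complexConj L) 3).Adelic => (β g).toReal • (f (borelHeight g : ℝ) * φ g * conj (borelConstantTerm ν 𝓕 (eisensteinSeriesU (fun g : (quasiSplit (↥(maximalRealSubfield L)) L (IsCMField.complexConj L) 3).Adelic => f' (borelHeight g : ℝ) * φ' g)) g - f' (borelHeight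 g : ℝ) * φ' g))) g ∂νG) := by
  classical
  obtain ⟨cμ, hcμ, hunf⟩ := exists_integral_quotFun_eisensteinSeriesU_mul_conj_eq (F := ↥(maximalRealSubfield L)) (E := L) (c := IsCMField.complexConj L) (N := 3) μ νG
  refine ⟨cμ, hcμ, ?_⟩
  intro β hβ χ₁ χ₁' χ₂ χ₂' φ φ' hχ₂ hχ₂' hφ hφc Cφ hφC hφ' hφ'c Cφ' hφ'C f f' hf hfs hf0 hf' hf's hf'0
  -- (0) structure, constants, the covering weight `β`, the three ★ packages (unfolding, AVG₃ needs none, (δ)₃ for the `L¹` letter)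
  haveI := t2Space_adeleRing_of_numberField L
  haveI := locallyCompactSpace_adeleRing' L
  haveI := secondCountableTopology_adeleRing L
  haveI : SecondCountableTopology (quasiSplit (↥(maximalRealSubfield L)) L (IsCMField.complexConj L) 3).Adelic := inferInstanceAs (SecondCountableTopology (adelic (↥(maximalRealSubfield L)) L (IsCMField.complexConj L) 3 ((StdForm.antidiagonal 3).over L)))
  have hc : IsCMField.complexConj L * IsCMField.complexConj L = 1 := AlgEquiv.ext fun x => IsCMField.complexConj_apply_apply L x
  have hc1 : IsCMField.complexConj L ≠ 1 := IsCMField.complexConj_ne_one L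
  have h2 := Algebra.IsQuadraticExtension.finrank_eq_two (↥(maximalRealSubfield L)) L
  haveI : ν.IsInvInvariant := isInvInvariant_of_isHaarMeasure_adelicUnipotent_three hc ν
  obtain ⟨hN1, hN2⟩ := locallyCompactSpace_and_secondCountableTopology_adelicUnipotent (F := ↥(maximalRealSubfield L)) (E := L) (c := IsCMField.complexConj L) (N := 3)
  haveI := hN1
  haveI := hN2
  haveI : SigmaFinite ν := inferInstance
  have h𝓕top : ν 𝓕 ≠ ∞ := ((measure_mono subset_closure).trans_lt h𝓕c.measure_lt_top).ne
  have h𝓕₀ : ν 𝓕 ≠ 0 := measure_ne_zero_of_isFundamentalDomain_rationalUnipotent ν h𝓕N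
  have hBK := exists_mem_borelAdelic_mul_mem_standardMaximalCompactGL_cm L (N := 3)
  have hKc : IsCompact ((((standardMaximalCompactGL 3 L).comap (adelicVal (↥(maximalRealSubfield L)) L (IsCMField.complexConj L) 3 ((StdForm.antidiagonal 3).over L)) : Subgroup (quasiSplit (↥(maximalRealSubfield L)) L (IsCMField.complexConj L) 3).Adelic)) : Set (quasiSplit (↥(maximalRealSubfield L)) L (IsCMField.complexConj L) 3).Adelic) := isCompact_comap_adelicVal_standardMaximalCompactGL
  haveI : CompactSpace ((standardMaximalCompactGL 3 L).comap (adelicVal (↥(maximalRealSubfield L)) L (IsCMField.complexConj L) 3 ((StdForm.antidiagonal 3).over L)) : Subgroup (quasiSplit (↥(maximalRealSubfield L)) L (IsCMField.complexConj L) 3).Adelic) := isCompact_iff_compactSpace.1 hKc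
  haveI : IsFiniteMeasure μK := CompactSpace.isFiniteMeasure
  haveI : DiscreteTopology (quasiSplit (↥(maximalRealSubfield L)) L (IsCMField.complexConj L) 3).arithmeticSubgroup := isDiscreteRational_quasiSplit
  haveI : DiscreteTopology ↥((arithmeticBorel (↥(maximalRealSubfield L)) L (IsCMField.complexConj L) 3).map (quasiSplit (↥(maximalRealSubfield L)) L (IsCMField.complexConj L) 3).arithmeticSubgroup.subtype) :=
    DiscreteTopology.of_subset ‹DiscreteTopology (quasiSplit (↥(maximalRealSubfield L)) L (IsCMField.complexConj L) 3).arithmeticSubgroup› (Subgroup.map_subtype_le _)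
  obtain ⟨K, -, hKt, hδ0, -⟩ := exists_integral_weight_smul_eq_mul_setIntegral_ideleClass_three h2 hc hc1 νG μK νI hBK h𝓕I
  have hIc : Continuous fun x : (AdeleRing (𝓞 L) L)ˣ => (IdeleClassGroup.ideleNorm L x : ℝ) := NNReal.continuous_coe.comp (continuous_ideleNorm_holds L)
  have hHc : Continuous fun g : (quasiSplit (↥(maximalRealSubfield L)) L (IsCMField.complexConj L) 3).Adelic => (borelHeight g : ℝ) := NNReal.continuous_coe.comp continuous_borelHeight
  -- names: `θ′`, `CT = θ′_B`, `J = θ′_B − (f′∘H)φ′`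
  set θ' : (quasiSplit (↥(maximalRealSubfield L)) L (IsCMField.complexConj L) 3).Adelic → ℂ := eisensteinSeriesU (fun g : (quasiSplit (↥(maximalRealSubfield L)) L (IsCMField.complexConj L) 3).Adelic => f' (borelHeight g : ℝ) * φ' g) with hθ'
  set CT : (quasiSplit (↥(maximalRealSubfield L)) L (IsCMField.complexConj L) 3).Adelic → ℂ := borelConstantTerm ν 𝓕 θ' with hCTdef
  set J : (quasiSplit (↥(maximalRealSubfield L)) L (IsCMField.complexConj L) 3).Adelic → ℂ := fun g => CT g - f' (borelHeight g : ℝ) * φ' g with hJdef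
  -- (1) `θ′`: Borel, `G(L⁺)`-invariant, bounded; `CT`: Borel; `J` Borel (its closed form is ★ C2, not needed here)
  obtain ⟨M₁, hM₁⟩ := exists_bound_eisensteinSeriesU_comp_borelHeight_mul_cm_three L hf' hf's hf'0 hφ'c hφ'C (hφ'.toAdelic_mul hχ₂')
  have hθ'm : Measurable θ' := measurable_eisensteinSeriesU_comp_borelHeight_mul_cm_three L hf' hf's hf'0 hφ'c hφ'C
  have hθ'G : ∀ (γ : (quasiSplit (↥(maximalRealSubfield L)) L (IsCMField.complexConj L) 3).arithmeticSubgroup) (x : (quasiSplit (↥(maximalRealSubfield L)) L (IsCMField.complexConj L) 3).Adelic), θ' ((γ : (quasiSplit (↥(maximalRealSubfield L)) L (IsCMField.complexConj L) 3).Adelic) * x) = θ' x := eisensteinSeriesU_comp_borelHeight_mul_arithmeticSubgroup_mul f' (hφ'.toAdelic_mul hχ₂')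
  have hCTm : Measurable CT := measurable_borelConstantTerm ν 𝓕 hθ'm
  have hJm : Measurable J := hCTm.sub (((hf'.comp hHc).measurable).mul hφ'c.measurable)
  -- (2) the `L¹` letter `∫⁻ β‖(f∘H)φ‖ < ∞` (★ (δ)₃ `[0,∞]` + ★ C3 §4)
  have hfm : Measurable fun g : (quasiSplit (↥(maximalRealSubfield L)) L (IsCMField.complexConj L) 3).Adelic => f (borelHeight g : ℝ) := (hf.comp hHc).measurable
  have hψm : Measurable fun g : (quasiSplit (↥(maximalRealSubfield L)) L (IsCMField.complexConj L) 3).Adelic => f (borelHeight g : ℝ) * φ g := hfm.mul hφc.measurable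
  have hHtk := borelHeight_torus_mul_maximalCompact_three (F := ↥(maximalRealSubfield L)) (E := L) (c := IsCMField.complexConj L)
  have hL1r : ∫⁻ g, β g * ‖f (borelHeight g : ℝ)‖ₑ ∂νG < ∞ := by
    have hL := hδ0 β hβ (fun g => ‖f (borelHeight g : ℝ)‖ₑ) hfm.enorm
      (fun n y => by simp only [borelHeight_unipotent_mul ((mem_unipotentInBorel_iff _).1 n.2)])
      (fun b hb y => by simp only [K2E1TruncatedEisensteinExplicit.borelHeight_arithmeticBorel_mul hb])
      (fun x => ‖f (IdeleClassGroup.ideleNorm L x : ℝ)‖ₑ * μK Set.univ) ((hf.comp hIc).measurable.enorm.mul_const _)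
      (fun k hk x => by simp only [map_mul, ideleNorm_principal hk, one_mul]) (fun t => by simp_rw [hHtk t]; exact lintegral_const _)
    rw [hL]
    exact ENNReal.mul_lt_top hKt.lt_top (setLIntegral_normSq_inv_mul_enorm_comp_lt_top νI h𝓕I hf hfs hf0 (measure_ne_top μK _))
  have hL1 : ∫⁻ g, β g * ‖f (borelHeight g : ℝ) * φ g‖ₑ ∂νG < ∞ := by
    have hφe : ∀ g, ‖φ g‖ₑ ≤ ENNReal.ofReal Cφ := fun g => by rw [← ofReal_norm]; exact ENNReal.ofReal_le_ofReal (hφC g)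
    calc ∫⁻ g, β g * ‖f (borelHeight g : ℝ) * φ g‖ₑ ∂νG ≤ ∫⁻ g, β g * ‖f (borelHeight g : ℝ)‖ₑ * ENNReal.ofReal Cφ ∂νG :=
          lintegral_mono fun g => by rw [enorm_mul, ← mul_assoc]; gcongr; exact hφe g
      _ = (∫⁻ g, β g * ‖f (borelHeight g : ℝ)‖ₑ ∂νG) * ENNReal.ofReal Cφ := lintegral_mul_const' _ _ ENNReal.ofReal_ne_top
      _ < ∞ := ENNReal.mul_lt_top hL1r ENNReal.ofReal_lt_top
  -- (3) unfolding `X → B(F)`-weight level; the average is free; the split `[Ψ]_β = [Ψ₁]_β + [Ψ₂]_β`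
  obtain ⟨hInt, hEq⟩ := hunf hβ (f := fun g => f (borelHeight g : ℝ) * φ g) (Λ' := θ') hψm (comp_borelHeight_mul_arithmeticBorel_mul f (hφ.toAdelic_mul hχ₂)) hθ'm hθ'G hM₁ hL1
  have hAVG := integral_wt_smul_mul_conj_eq_mul_conj_borelConstantTerm_three hc hc1 νG ν h𝓕N h𝓕₀ h𝓕top hβ (ψ := fun g => f (borelHeight g : ℝ) * φ g) (Λ' := θ') hψm hθ'm
    (comp_borelHeight_mul_unipotent_mul f hφ.unipotent_mul) (comp_borelHeight_mul_arithmeticBorel_mul f (hφ.toAdelic_mul hχ₂)) (fun b _ x => hθ'G b x) (lintegral_weight_mul_conj_lt_top νG β hM₁ hL1)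
  have hsplit : ∀ g : (quasiSplit (↥(maximalRealSubfield L)) L (IsCMField.complexConj L) 3).Adelic, (β g).toReal • ((fun g : (quasiSplit (↥(maximalRealSubfield L)) L (IsCMField.complexConj L) 3).Adelic => f (borelHeight g : ℝ) * φ g) g * conj (borelConstantTerm ν 𝓕 θ' g)) =
      (β g).toReal • (f (borelHeight g : ℝ) * φ g * conj (f' (borelHeight g : ℝ) * φ' g)) + (β g).toReal • (f (borelHeight g : ℝ) * φ g * conj (J g)) := fun g => by
    rw [← smul_add, hJdef]
    congr 1
    simp only [map_sub]
    change f (borelHeight g : ℝ) * φ g * conj (CT g) = _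
    ring
  -- (4) both brackets are absolutely convergent: `(f′∘H)φ′` and `J` are bounded, and `∫⁻ β‖(f∘H)φ‖ < ∞`
  obtain ⟨Mf, hMf⟩ := hf's.exists_bound_of_continuous hf'
  have hΛ₁m : Measurable fun g : (quasiSplit (↥(maximalRealSubfield L)) L (IsCMField.complexConj L) 3).Adelic => f' (borelHeight g : ℝ) * φ' g := ((hf'.comp hHc).measurable).mul hφ'c.measurable
  have hΛ₁b : ∀ g : (quasiSplit (↥(maximalRealSubfield L)) L (IsCMField.complexConj L) 3).Adelic, ‖f' (borelHeight g : ℝ) * φ' g‖ ≤ max Mf 0 * max Cφ' 0 := fun g => by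
    rw [norm_mul]
    exact mul_le_mul ((hMf _).trans (le_max_left _ _)) ((hφ'C g).trans (le_max_left _ _)) (norm_nonneg _) (le_max_right _ _)
  have hβtop : ∀ g, β g ≠ ∞ := fun g => ne_top_of_le_ne_top ENNReal.one_ne_top (hβ.le_one g)
  have hconv : ∀ {Λ : (quasiSplit (↥(maximalRealSubfield L)) L (IsCMField.complexConj L) 3).Adelic → ℂ} {M : ℝ}, Measurable Λ → (∀ g, ‖Λ g‖ ≤ M) →
      Integrable (fun g : (quasiSplit (↥(maximalRealSubfield L)) L (IsCMField.complexConj L) 3).Adelic => (β g).toReal • (f (borelHeight g : ℝ) * φ g * conj (Λ g))) νG := by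
    intro Λ M hΛm hΛb
    refine ⟨(hβ.measurable.ennreal_toReal.smul (hψm.mul (continuous_conj.measurable.comp hΛm))).aestronglyMeasurable, ?_⟩
    rw [HasFiniteIntegral]
    calc ∫⁻ g, ‖(β g).toReal • (f (borelHeight g : ℝ) * φ g * conj (Λ g))‖ₑ ∂νG = ∫⁻ g, β g * ‖f (borelHeight g : ℝ) * φ g * conj (Λ g)‖ₑ ∂νG := by
          refine lintegral_congr fun g => ?_
          rw [enorm_smul, Real.enorm_eq_ofReal ENNReal.toReal_nonneg, ENNReal.ofReal_toReal (hβtop g)]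
      _ < ∞ := lintegral_weight_mul_conj_lt_top νG β hΛb hL1
  have hI₁ := hconv hΛ₁m hΛ₁b
  have hJb : ∀ g : (quasiSplit (↥(maximalRealSubfield L)) L (IsCMField.complexConj L) 3).Adelic, ‖J g‖ ≤ max M₁ 0 + max Mf 0 * max Cφ' 0 := fun g => by
    rw [hJdef]
    exact (norm_sub_le _ _).trans (add_le_add (norm_borelConstantTerm_le ν h𝓕top hM₁ g) (hΛ₁b g))
  have hI₂ := hconv hJm hJb
  refine ⟨hInt, hI₁, hI₂, ?_⟩
  rw [hEq, hAVG, integral_congr_ae (ae_of_all _ hsplit), integral_add hI₁ hI₂]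

end Summit.HodgeConjecture.HodgeConjecture.Cruxes.H413.K2E1ChiPseudoEisensteinBracketsCMThree

end
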